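import Literature.Analysis.FluidPDE.DissipationAnomalyProofs
import Literature.Analysis.FluidPDE.LerayHopfSpectralMeasurability
import Mathlib.MeasureTheory.Function.Floor
import HarnessLib

/-!
# Jointly measurable `L²` weak-gradient witnesses of a global Leray–Hopf solution

A Leray–Hopf weak solution `u` of NS_ν(f) on `T^d` lies in `L²(0,T;H¹)` for every `T`; being an
element of a Bochner space, its gradient has a STRONGLY (jointly) measurable representative on
`(0,T) × T^d` (Robinson–Rodrigo–Sadowski 2016, Def. 1.22–1.25; Evans 2010, §5.9.2). In the tree this
is the accepted fact `Torus.IsLerayHopfOn.exists_hasWeakGradient_holds`: an a.e.-strongly-measurable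
matrix field `G` on `[0,T] × T^d` with `HasWeakGradient (u t) (G t)`, `G t ∈ L¹` and
`∫⁻ |G t|² = eGradNormSq (u t)` for a.e. `t ∈ (0,T)`. Route statements (e.g. the decomp-ad items
`SymmetricLerayHopfTG`, `WitnessDissipationBridgeTG`) ask instead for a family
`g : ℝ → d → (T^d → E)` with `uncurry (t,x) ↦ g t j x` MEASURABLE for each `j`, and
`g t j ∈ L²`, `HasWeakPartialDeriv j (u t) (g t j)` for a.e. `t > 0` — globally in time.
This file supplies exactly that, for every global Leray–Hopf solution:

* `Torus.HasWeakPartialDeriv.congr_witness_ae` — a weak partial derivative may be modified on a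
  null set.
* `Torus.IsLerayHopfOn.exists_stronglyMeasurable_hasWeakGradient` — the weak gradient on a horizon
  may be taken (everywhere-defined and) strongly measurable in `(t,x)` (`AEStronglyMeasurable.mk`
  plus Fubini `Measure.ae_ae_of_ae_prod`).
* `Torus.IsLerayHopfOn.exists_measurable_witness` — on a horizon: measurable `L²` witnesses of the
  partial derivatives for a.e. `t ∈ (0,T)`.
* `Torus.IsGlobalLerayHopf.exists_measurable_witness` — GLOBAL version, a.e. `t > 0`, by pasting the
  horizon-`(n+1)` witnesses along `n = ⌊t⌋₊` (countable pasting `measurable_from_prod_countable_right`,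
  `Nat.measurable_floor`).

References: J. C. Robinson, J. L. Rodrigo, W. Sadowski, *The Three-Dimensional Navier–Stokes
Equations*, CUP 2016, Def. 1.22–1.25 (PDF p. 36) [RobinsonRodrigoSadowski2016]; L. C. Evans,
*Partial Differential Equations*, 2nd ed., AMS 2010, §5.2.1, §5.9.2 [Evans2010].
-/

open MeasureTheory Filter Set Function
open scoped ENNReal NNReal RealInnerProductSpace

noncomputable section

namespace Literature.Analysis.FluidPDE

variable {d : Type*} [Fintype d] [DecidableEq d]

/-- A weak partial derivative may be modified on a null set: if `g` is a weak `i`-th partial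
derivative of `f` on `T^d` and `g = g'` a.e., so is `g'` (Evans 2010, §5.2.1, Remark). [cite: Evans2010, §5.2.1] -/
theorem _root_.Literature.Analysis.FunctionSpaces.Torus.HasWeakPartialDeriv.congr_witness_ae
    {F : Type*} [NormedAddCommGroup F] [NormedSpace ℝ F] {i : d} {f g g' : UnitAddTorus d → F}
    (h : FunctionSpaces.Torus.HasWeakPartialDeriv i f g) (hg : g =ᵐ[volume] g') :
    FunctionSpaces.Torus.HasWeakPartialDeriv i f g' := by
  intro φ hφ
  have e : ∫ x, φ x • g' x = ∫ x, φ x • g x :=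
    integral_congr_ae (by filter_upwards [hg] with x hx; rw [hx])
  rw [e]
  exact h φ hφ

/-- **Strongly measurable weak gradient on a horizon.** Along a Leray–Hopf solution on `[0, T)`
there is a matrix field `G : ℝ → T^d → (E →L E)`, STRONGLY measurable as a function of `(t, x)`,
with, for a.e. `t ∈ (0, T)`: `HasWeakGradient (u t) (G t)`, `G t ∈ L¹` and
`∫⁻ |G t|² = eGradNormSq (u t)`. It is the strongly measurable modification
(`AEStronglyMeasurable.mk`) of the witness of `Torus.IsLerayHopfOn.exists_hasWeakGradient_holds`; the
slices agree a.e. for a.e. `t` by Fubini (`Measure.ae_ae_of_ae_prod`), and weak derivatives,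
integrability and the `L²` identity pass to a.e.-modified slices (Robinson–Rodrigo–Sadowski 2016,
Def. 1.22–1.25; Evans 2010, §5.9.2). [cite: RobinsonRodrigoSadowski2016, Def. 1.22–1.25 (PDF p. 36)] -/
theorem Torus.IsLerayHopfOn.exists_stronglyMeasurable_hasWeakGradient {T ν : ℝ}
    {F u : ℝ → UnitAddTorus d → EuclideanSpace ℝ d} {u₀ : UnitAddTorus d → EuclideanSpace ℝ d}
    (hu : Torus.IsLerayHopfOn T ν F u₀ u) :
    ∃ G : ℝ → UnitAddTorus d → EuclideanSpace ℝ d →L[ℝ] EuclideanSpace ℝ d,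
      StronglyMeasurable (uncurry G) ∧
      ∀ᵐ t ∂(volume.restrict (Ioo 0 T)),
        HasWeakGradient (u t) (G t) ∧ Integrable (G t) volume ∧
          ∫⁻ x, ENNReal.ofReal (weakGradNormSq (G t) x) = FunctionSpaces.Torus.eGradNormSq (u t) := by
  obtain ⟨G, hGm, hG⟩ := Torus.IsLerayHopfOn.exists_hasWeakGradient_holds hu
  set Gm : ℝ × UnitAddTorus d → EuclideanSpace ℝ d →L[ℝ] EuclideanSpace ℝ d := hGm.mk (uncurry G)
    with hGm_def
  refine ⟨curry Gm, ?_, ?_⟩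
  · rw [uncurry_curry]; exact hGm.stronglyMeasurable_mk
  -- the strip measure is a product measure
  have hμ : (volume.restrict (Icc 0 T ×ˢ (univ : Set (UnitAddTorus d))) :
      Measure (ℝ × UnitAddTorus d)) = (volume.restrict (Icc 0 T)).prod volume := by
    rw [Measure.volume_eq_prod, ← Measure.prod_restrict, Measure.restrict_univ]
  -- slices agree a.e., for a.e. `t ∈ [0, T]`
  have hae : uncurry G =ᵐ[(volume.restrict (Icc 0 T)).prod volume] Gm := by
    have h1 : uncurry G =ᵐ[volume.restrict (Icc 0 T ×ˢ univ)] Gm := hGm.ae_eq_mk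
    rwa [hμ] at h1
  have hslice : ∀ᵐ t ∂(volume.restrict (Ioo 0 T)), G t =ᵐ[volume] curry Gm t :=
    ae_restrict_of_ae_restrict_of_subset Ioo_subset_Icc_self
      ((Measure.ae_ae_of_ae_prod hae).mono fun t ht => ht.mono fun x hx => hx)
  filter_upwards [hG, hslice] with t ht hts
  obtain ⟨hwg, hGi, hGeq⟩ := ht
  refine ⟨fun i => FunctionSpaces.Torus.HasWeakPartialDeriv.congr_witness_ae (hwg i)
      (hts.mono fun x hx => by simp only [hx]), hGi.congr hts, ?_⟩
  rw [← hGeq]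
  refine lintegral_congr_ae (hts.mono fun x hx => ?_)
  simp only [weakGradNormSq, hx]

/-- The squared norm of one column of a matrix is at most its Frobenius norm squared:
`‖G eⱼ‖² ≤ |G|²_F` (`frobeniusNormSq = ∑ᵢ ‖G eᵢ‖²`). [folklore] -/
private theorem Torus.norm_sq_apply_single_le_weakGradNormSq
    (G : UnitAddTorus d → EuclideanSpace ℝ d →L[ℝ] EuclideanSpace ℝ d) (x : UnitAddTorus d) (j : d) :
    ‖G x (EuclideanSpace.single j 1)‖ ^ 2 ≤ weakGradNormSq G x := by
  rw [Torus.weakGradNormSq_eq_sum]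
  exact Finset.single_le_sum (f := fun i => ‖G x (EuclideanSpace.single i 1)‖ ^ 2)
    (fun i _ => sq_nonneg _) (Finset.mem_univ j)

/-- **Measurable `L²` witnesses on a horizon.** Along a Leray–Hopf solution on `[0, T)` there is a
family `g : ℝ → d → (T^d → E)`, with `(t, x) ↦ g t j x` measurable for every `j`, such that for
a.e. `t ∈ (0, T)` and every `j`: `g t j ∈ L²(T^d)` and `g t j` is a weak `j`-th partial derivative of
`u t` — namely the columns `g t j x = G t x eⱼ` of the strongly measurable weak gradient
(`…exists_stronglyMeasurable_hasWeakGradient`); `‖G t · eⱼ‖² ≤ |G t|²` has finite integral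
`≤ eGradNormSq (u t) < ∞` for a.e. `t` (field `memL2Sobolev` via the `L²` identity)
(Robinson–Rodrigo–Sadowski 2016, Def. 1.22–1.25; Evans 2010, §5.9.2). [cite: RobinsonRodrigoSadowski2016, Def. 1.22–1.25 (PDF p. 36)] -/
theorem Torus.IsLerayHopfOn.exists_measurable_witness {T ν : ℝ}
    {F u : ℝ → UnitAddTorus d → EuclideanSpace ℝ d} {u₀ : UnitAddTorus d → EuclideanSpace ℝ d}
    (hu : Torus.IsLerayHopfOn T ν F u₀ u) :
    ∃ g : ℝ → d → UnitAddTorus d → EuclideanSpace ℝ d,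
      (∀ j, Measurable (uncurry fun t x => g t j x)) ∧
      ∀ᵐ t ∂(volume.restrict (Ioo 0 T)), ∀ j, MemLp (g t j) 2 volume ∧
        FunctionSpaces.Torus.HasWeakPartialDeriv j (u t) (g t j) := by
  obtain ⟨G, hGm, hG⟩ := hu.exists_stronglyMeasurable_hasWeakGradient
  refine ⟨fun t j x => G t x (EuclideanSpace.single j 1), fun j => ?_, ?_⟩
  · exact (ContinuousLinearMap.apply ℝ (EuclideanSpace ℝ d) (EuclideanSpace.single j 1)).measurable.comp
      hGm.measurable
  -- `eGradNormSq (u t) < ∞` for a.e. `t ∈ (0, T)` (`∫₀ᵀ ‖∇u‖₂² < ∞`, field `memL2Sobolev`)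
  have hfin : ∀ᵐ t ∂(volume.restrict (Ioo 0 T)), FunctionSpaces.Torus.eGradNormSq (u t) < ∞ :=
    ae_lt_top' hu.aemeasurable_eGradNormSq hu.lintegral_eGradNormSq_lt_top.ne
  filter_upwards [hG, hfin] with t ht htfin j
  obtain ⟨hwg, hGi, hGeq⟩ := ht
  have hmeas : AEStronglyMeasurable (fun x => G t x (EuclideanSpace.single j 1)) volume :=
    (hGi.apply_continuousLinearMap _).aestronglyMeasurable
  refine ⟨?_, hwg j⟩
  -- `MemLp 2` from the finite `L²` integral of the column
  refine (memLp_two_iff_integrable_sq_norm hmeas).2 ⟨(hmeas.norm.pow 2), ?_⟩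
  refine (hasFiniteIntegral_iff_ofReal (ae_of_all _ fun x => sq_nonneg _)).2 ?_
  calc ∫⁻ x, ENNReal.ofReal (‖G t x (EuclideanSpace.single j 1)‖ ^ 2)
      ≤ ∫⁻ x, ENNReal.ofReal (weakGradNormSq (G t) x) :=
        lintegral_mono fun x => ENNReal.ofReal_le_ofReal (Torus.norm_sq_apply_single_le_weakGradNormSq _ _ _)
    _ = FunctionSpaces.Torus.eGradNormSq (u t) := hGeq
    _ < ∞ := htfin

/-- **Measurable `L²` witnesses, globally in time.** Along a GLOBAL Leray–Hopf solution of NS_ν(F)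
on `T^d` there is a family `g : ℝ → d → (T^d → E)` with `(t, x) ↦ g t j x` measurable for every `j`
and, for a.e. `t > 0` and every `j`, `g t j ∈ L²(T^d)` a weak `j`-th partial derivative of `u t`.
Proof: paste the horizon-`(n+1)` witnesses of `…IsLerayHopfOn.exists_measurable_witness` along
`n = ⌊t⌋₊` (`t ∈ (0, n+1)`); measurability by countable pasting
(`measurable_from_prod_countable_right`, `Nat.measurable_floor`), the a.e. clause from
`ae_all_iff` over `n` (Robinson–Rodrigo–Sadowski 2016, Def. 1.22–1.25; Evans 2010, §5.9.2). This is
the witness clause `∃ g, (∀ j, Measurable (uncurry fun t x => g t j x)) ∧ ∀ᵐ t, 0 < t → ∀ j, MemLp (g t j) 2 ∧ HasWeakPartialDeriv j (u t) (g t j)`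
of route statements, discharged for every global Leray–Hopf solution. [cite: RobinsonRodrigoSadowski2016, Def. 1.22–1.25 (PDF p. 36)] -/
theorem Torus.IsGlobalLerayHopf.exists_measurable_witness {ν : ℝ}
    {F u : ℝ → UnitAddTorus d → EuclideanSpace ℝ d} {u₀ : UnitAddTorus d → EuclideanSpace ℝ d}
    (hu : Torus.IsGlobalLerayHopf ν F u₀ u) :
    ∃ g : ℝ → d → UnitAddTorus d → EuclideanSpace ℝ d,
      (∀ j, Measurable (uncurry fun t x => g t j x)) ∧
      ∀ᵐ t : ℝ, 0 < t → ∀ j, MemLp (g t j) 2 volume ∧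
        FunctionSpaces.Torus.HasWeakPartialDeriv j (u t) (g t j) := by
  have h := fun n : ℕ => (hu ((n : ℝ) + 1) (by positivity)).exists_measurable_witness
  choose g hgm hg using h
  refine ⟨fun t => g ⌊t⌋₊ t, fun j => ?_, ?_⟩
  · -- countable pasting
    have h1 : Measurable fun q : ℕ × (ℝ × UnitAddTorus d) => g q.1 q.2.1 j q.2.2 :=
      measurable_from_prod_countable_right fun n => hgm n j
    have h2 : Measurable fun p : ℝ × UnitAddTorus d => (⌊p.1⌋₊, p) :=
      ((Nat.measurable_floor (R := ℝ)).comp measurable_fst).prodMk measurable_id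
    exact h1.comp h2
  · have hall : ∀ᵐ t : ℝ, ∀ n : ℕ, t ∈ Ioo (0 : ℝ) ((n : ℝ) + 1) → ∀ j, MemLp (g n t j) 2 volume ∧
        FunctionSpaces.Torus.HasWeakPartialDeriv j (u t) (g n t j) :=
      ae_all_iff.2 fun n => (ae_restrict_iff' measurableSet_Ioo).1 (hg n)
    filter_upwards [hall] with t ht ht0
    exact ht ⌊t⌋₊ ⟨ht0, Nat.lt_floor_add_one t⟩

end Literature.Analysis.FluidPDE

end
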